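import Literature.MathematicalPhysics.QuantumFieldTheory.Balaban1983to89.B15Sect1Instances
import Literature.MathematicalPhysics.QuantumFieldTheory.Balaban1983to89.B15Extension193

/-!
# `Balaban1983to89.B15Eq175ExtensionWitness` — T. Bałaban, *Large field renormalization. I. The basic step of the 𝐑 operation*,
# Commun. Math. Phys. **122** (1989) 175–202 [Balaban1989LargeFieldI] = «[IV]», (1.75) p. 193: the p. 193 CONSTRUCTION of an
# extension of `V_k↾_{Z∩Λ^c}` into `Λ` (r12's `B15Extension193.extend`) INHABITS the extension type `B15Sect1Instances.Ext175` over
# which print's (1.75) infimum runs — the located junction `B15Extension193.Touches Λ b ↔ b ∈ B15DeterminingSets.bondsOf Λ`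

statement-level skeleton of published theorems with citation tags; proofs where landed; nothing here is a claim about
the Yang–Mills mass gap

PDF held: `paper:balaban1989-cmp122-large-field-i` (journal page = PDF page + 174); p. 193 [PDF 19] read on the ×2 render
`run/shared/lean/pub/pub-balaban/b2b-balaban-ref1/pages/1989-cmp122-large-field-I/1989-cmp122-large-field-I-p019-x2.png`.

CITATION HEADER / WHAT IS REPRODUCED (mega-formalization `lit-balaban`, HOME `run/shared/lean/pub/lit-balaban/`; unit
`lit-balaban-r11` gens 109–110 (drafted g109, validated and filed g110), PROXY CONSTITUENT for block B15 under the lead's ruling G.5-61; the junction was LOCATED by the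
DEFINITIONS steward r20 gen 64 (`lit-balaban-r11/INBOX.md` 2026-08-24T20:08:09Z) and is filed here as a separate leaf so that the
light instance file `B15Sect1Instances` keeps its imports).  SKELETON row served (cells only; the head is already carried by
`B15Sect1Instances.chi175std` p385406): **B15.Eq1.75**.  v1 = p388667 ✓ e8e34ae8f0ce; v1.1 = DOC-ONLY fix F-g109-1 (code
byte-identical).

THE PRINT (p. 193, verbatim on the text layer p0019 L4–6, re-read 2026-08-25 — v1.1 DOCFIX F-g109-1, referee-5 g109: v1 had
glossed this sentence): *"The restriction introduced by this function is on the field V_k↾_{Z∩Λ^c} only. It means that this field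
has an extension on the whole domain Z, such that the extended field satisfies the regularity condition in (1.75)."*; the
construction (L14–17, also quoted in r12's `B15Extension193`): *"We extend it putting V′_k(b′) = 1 for b′∈Λ. … Now we apply the
inverse gauge transformation on ∂⁺Λ, and we get a configuration V_k defined on the whole domain, equal to the given one on Z∩Λ^c,
and satisfying the regularity condition |∂V_k − 1| < O(1)M²ε."*; its consequences (L17–18, L22–24): *"The corresponding
configuration U_{k,Z} satisfies the condition |∂U_{k,Z} − 1| < O(1)B₃M²εη²."* … *"hence the function U_{k,Z} is defined for all
those fields, and the condition in (1.75) has a meaning."*  (OUR GLOSS, not print's words: the regularity condition "in (1.75)" is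
the condition on `U_{k,Z}` of the extended field over the plaquettes of `Ω^c_k` — the hypothesis `h` of `chi175std_of_extend`.)

WHAT IS PROVED.  `touches_iff_mem_bondsOf`: r12's bond predicate *"b′∈Λ"* (`B15Extension193.Touches`) IS membership in
`B15DeterminingSets.bondsOf` (definitional) and `outBonds Λ = (bondsOf Λ)ᶜ`; hence **`extendExt175`**: for every gauge transformation
`g` of `T^{(k)}` the p. 193 extension `extend Λ^{(k)} g V_k` is an element of `Ext175 Λ k V_k` (it agrees with `V_k` off the bonds
meeting `Λ^{(k)}`, by r12's `extend_eq_of_mem_outBonds`); `Ext175` is therefore nonempty, and **`chi175std_of_extend`**: print's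
sentence — (1.75) `χ_{k,Λ}(V_k) = 1` as soon as `U_{k,Z}` of ONE such extension satisfies the regularity `|U_{k,Z}(∂p) − 1| < 2ε_kη²`
on the plaquettes of `Ω^c_k` (the regularity itself is p. 193's estimate, row B15.Claim@193 ∕ r12's `largeField193`, not asserted
here).  No `sorry`, no `Prop` fact, no new axiom.
-/

noncomputable section

namespace Literature.MathematicalPhysics.QuantumFieldTheory.Balaban1983to89.B15Eq175ExtensionWitness

open Literature.MathematicalPhysics.QuantumFieldTheory.Balaban1983to89
open B15DeterminingSets B14.Eq213DetSet B15Sect1Instances B15Extension193 B8Eq17ClassAkV1 GaugeField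
open Set

variable {P : Params} {G : Type*}

/-! ## §1  The junction: «b′ ∈ Λ» of p. 193 is membership in `bondsOf Λ` -/

/-- r12's *"b′∈Λ"* (`Touches Λ b`: an end of `b` in `Λ`) IS `b ∈ bondsOf Λ` (the bonds meeting `Λ`, (1.20)'s carrier) — definitional.
[cite: Balaban1989LargeFieldI, (1.75) p.193] -/
theorem touches_iff_mem_bondsOf {k : ℕ} (Λ' : Set (Site P k)) (b : PBond P k) : Touches Λ' b ↔ b ∈ bondsOf Λ' := Iff.rfl

/-- The bonds of `Z∩Λ^c` (*"equal to the given one on Z∩Λ^c"*) are the complement of the bonds meeting `Λ`.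
[cite: Balaban1989LargeFieldI, (1.75) p.193] -/
theorem outBonds_eq_compl_bondsOf {k : ℕ} (Λ' : Set (Site P k)) : outBonds Λ' = (bondsOf Λ')ᶜ := by
  ext b
  exact mem_outBonds_iff_not_touches b

variable [GaugeGroup G]

/-! ## §2  The p. 193 construction inhabits `Ext175` -/

/-- **The p. 193 extension as an element of the (1.75) extension type**: for a gauge transformation `g` of `T^{(k)}` (print: the axial
gauge transformation of `V_k` near `∂⁺Λ`), `extend Λ^{(k)} g V_k ∈ Ext175 Λ k V_k` — it agrees with `V_k` on every bond not meeting
`Λ^{(k)}` (r12's `extend_eq_of_mem_outBonds`). [cite: Balaban1989LargeFieldI, (1.75) p.193] -/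
def extendExt175 (Λ : Set (Site P 0)) (k : ℕ) (g : GaugeTransf P k G) (Vk : GaugeField P k G) : Ext175 Λ k Vk :=
  ⟨extend (pts k Λ) g Vk, fun b hb => extend_eq_of_mem_outBonds g Vk ((mem_outBonds_iff_not_touches b).2 hb)⟩

/-- The underlying configuration of `extendExt175` is r12's `extend` (definitional). [cite: Balaban1989LargeFieldI, (1.75) p.193] -/
theorem extendExt175_val (Λ : Set (Site P 0)) (k : ℕ) (g : GaugeTransf P k G) (Vk : GaugeField P k G) :
    (extendExt175 Λ k g Vk).1 = extend (pts k Λ) g Vk := rfl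

/-- *"this field has an extension on the whole domain Z"*: the extension type of (1.75) is inhabited (e.g. by the extension with
`g ≡ 1`). [cite: Balaban1989LargeFieldI, (1.75) p.193] -/
instance nonempty_ext175 (Λ : Set (Site P 0)) (k : ℕ) (Vk : GaugeField P k G) : Nonempty (Ext175 Λ k Vk) :=
  ⟨extendExt175 Λ k (fun _ => 1) Vk⟩

variable {av : ∀ j, Averaging P j G} (bg : DetBackground P G av) (M₁ : ℕ)

/-- **(1.75) from the p. 193 construction**: if the background `U_{k,Z}` ((1.74) at print's instance, `bgKZstd`) of ONE p. 193 extension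
`extend Λ^{(k)} g V_k` satisfies `|U_{k,Z}(∂p) − 1| < 2ε_kη²` for the plaquettes of `Ω^c_k`, then `χ_{k,Λ}(V_k) = 1` (`chi175std`) —
print's *"such that the extended field satisfies the regularity condition in (1.75)"* (p. 193 L5–6; the estimate feeding the
hypothesis is p. 193's *"The corresponding configuration U_{k,Z} satisfies the condition |∂U_{k,Z} − 1| < O(1)B₃M²εη²"*, row
B15.Claim@193, not asserted here). [cite: Balaban1989LargeFieldI, (1.75) p.193] -/
theorem chi175std_of_extend (Z Λ : Set (Site P 0)) (k : ℕ) (Ω : ℕ → Set (Site P 0)) (εk η : ℝ) (g : GaugeTransf P k G)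
    (Vk : GaugeField P k G)
    (h : PlaqSmallOn (plaqsOf (Ω k)ᶜ) (2 * εk * η ^ 2) (bgKZstd bg M₁ Z k (extend (pts k Λ) g Vk))) :
    chi175std bg M₁ Z Λ k Ω εk η Vk :=
  ⟨extendExt175 Λ k g Vk, h⟩

end Literature.MathematicalPhysics.QuantumFieldTheory.Balaban1983to89.B15Eq175ExtensionWitness

end
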